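import Literature.NumberTheory.ModularSymbols.PeriodHomologyGroupPresentationCocycleCount
import Literature.NumberTheory.ModularSymbols.PeriodHomologyGroupPresentation
import Literature.NumberTheory.EllipticCurves.ModularSymbolsEichlerShimuraHoldsProofs
import Mathlib.GroupTheory.Abelianization.Defs
import Mathlib.Algebra.Module.Projective
import Mathlib.LinearAlgebra.FreeModule.PID
import Mathlib.Algebra.Module.ZMod
import Mathlib.Algebra.Field.ZMod
import Mathlib.LinearAlgebra.Basis.VectorSpace
import Mathlib.LinearAlgebra.FiniteDimensional.Lemmas
import Mathlib.RingTheory.Noetherian.Orzech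
import HarnessLib

/-!
# Knapp's Prop. 11.22 discharged: the period homomorphism `γ ↦ {∞, γ∞}` on `Γ₀(N)` vanishes ONLY on
# `Γ_ep · [Γ₀(N), Γ₀(N)]` — proof of the named fact `periodFunctional_ker_le_ellipticParabolic_sup_commutator`

Topic `Literature/NumberTheory/ModularSymbols`; sequel to `PeriodHomologyGroupPresentation` (Knapp's `Γ_ep`, the
easy half `Γ_ep·[Γ₀,Γ₀] ≤ ker`, and the NAMED FACT `periodFunctional_ker_le_ellipticParabolic_sup_commutator`:
zero periods only on `Γ_ep·[Γ₀(N),Γ₀(N)]`) and `PeriodHomologyGroupPresentationCocycleCount`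
(`dim_F Hom(Γ₀(N)ᵃᵇ/Γ_epᵃᵇ, F) ≤ 2 dim_ℂ S₂(Γ₀(N))` for every field `F`).  MAIN THEOREM:

  `periodFunctional_ker_le_ellipticParabolic_sup_commutator_holds :
      periodFunctional_ker_le_ellipticParabolic_sup_commutator`

i.e. **for every `N ≥ 1` and `γ ∈ Γ₀(N)`: if `{∞, γ∞}_h = 0` for all `h ∈ S₂(Γ₀(N))` then `γ` lies in the
subgroup generated by the elliptic elements, the parabolic elements and the commutators** (Knapp 1993,
Prop. 11.22 with (11.37), (11.42): `H₁(X₀(N), ℤ) ≅ Γ₀(N)ᵃᵇ/Γ_epᵃᵇ` realised INTEGRALLY by periods; Manin 1972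
Thm. 1.9 / Cremona 1997 Thm. 2.1.2 over `ℤ`).  With the easy half already in the tree this gives
`ker(γ ↦ {∞, γ∞}) = Γ_ep ⊔ [Γ₀(N), Γ₀(N)]` unconditionally (`ker_periodFunctionalHom_eq_holds`).

## Proof (algebraic; NOT Knapp's topological argument)

Knapp proves 11.22 by Van Kampen on `ℋ* → X₀(N)` and the de Rham pairing (11.42).  Neither the topology
of `X₀(N)` nor a Kurosh/Farey-symbol structure theorem for `Γ₀(N)` is available, so the integral statement is
obtained here from two inputs the tree DOES have, by a counting argument over the prime fields:

1. **Eichler–Shimura rank** (`periodHomology_eq_span_basis_holds`, `ModularSymbolsEichlerShimuraHoldsProofs`):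
   the period homology `H = {h ↦ {∞, γ∞}_h}` is the `ℤ`-span of an `ℝ`-basis of `S₂(Γ₀(N))^∨`, hence free
   of rank `n = 2 dim_ℂ S₂(Γ₀(N))`.
2. **The count over `𝔽_ℓ`** (`finrank_epCocycles_le_two_mul_finrank` at `F = ZMod ℓ`): for every prime
   `ℓ`, `dim_{𝔽_ℓ} Hom(A, 𝔽_ℓ) ≤ n`, where `A = Γ₀(N)ᵃᵇ/(image of Γ_ep)` (`abQuot N`; a homomorphism
   `A → 𝔽_ℓ` is exactly a cocycle `Γ₀(N) → 𝔽_ℓ` killing parabolic and elliptic elements).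

The period map induces a surjection `per : A ↠ H ≅ ℤⁿ` (`quotPeriod`).  Pulling back along it embeds
`Hom(H, 𝔽_ℓ) ≅ 𝔽_ℓⁿ` into `Hom(A, 𝔽_ℓ)`, of dimension `≤ n`, so the pull-back is onto: EVERY homomorphism
`A → 𝔽_ℓ` factors through `per`.  As `H` is free, `per` splits, `A = s(H) ⊕ B` with `B = ker per`, and
therefore `Hom(B, 𝔽_ℓ) = 0` for every prime `ℓ`.  A finitely generated abelian group with no non-zero
homomorphism to any `ℤ/ℓ` is trivial (`eq_zero_of_forall_hom_zmod`: `B = ℓB` for all `ℓ`, so multiplication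
by `ℓ` is onto, hence injective by Vasconcelos/Orzech — `B` is torsion-free, hence free, and a free module of
positive rank maps onto `ℤ/2`).  So `per` is injective (`quotPeriod_injective`), which is the statement:
`{∞, γ∞} = 0` forces the class of `γ` in `A` to vanish, i.e. `γ ∈ Γ_ep·[Γ₀(N),Γ₀(N)]`.

Everything here is a THEOREM (0 named facts, no instance, no notation, no `sorry`; plumbing definitions
`abGamma0`, `epImage`, `abQuot`, `cls`, `abPeriod`, `quotPeriod`; helpers `private`).  Consumers: E32a
`CuspidalHomologyPrymFixedPointSpan.prymLatticeFixedPointSpan_of_periodKernelFact` (route TameQuarticManinParity,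
stmt-BirchSwinnertonDyer-23756) and everything conditional on the fact can now be fed `…_holds`.  Nothing about
any elliptic curve is asserted; BSD is not touched.

## References

* A. W. Knapp, *Elliptic Curves*, Math. Notes 40 (1993), Prop. 11.22 (PDF p. 242), (11.34)–(11.37) (p. 243),
  Prop. 11.13 (p. 239), (11.42) (p. 246). [Knapp1993]
* Ju. I. Manin, *Parabolic points and zeta functions of modular curves* (1972), §1.5, Thm. 1.9. [Manin1972]
* J. E. Cremona, *Algorithms for modular elliptic curves*, 2nd ed. (1997), §2.1 Thm. 2.1.2, §2.2. [CremonaAlgorithms1997]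
* G. Shimura, *Introduction to the arithmetic theory of automorphic functions* (1971), §8.1–8.2. [ShimuraIATAF1971]
* W. V. Vasconcelos, *On finitely generated flat modules*, Trans. AMS 138 (1969) (surjective endomorphisms of
  finitely generated modules are injective; Mathlib `OrzechProperty`). [folklore]
-/

noncomputable section

open scoped MatrixGroups ModularForm

open CongruenceSubgroup
open Literature.NumberTheory.EllipticCurves.ModularForms

namespace Literature.NumberTheory.ModularSymbols

/-! ### Algebra: a finitely generated abelian group with no homomorphism onto any `ℤ/ℓ` is trivial -/

section Algebra

variable {B : Type*} [AddCommGroup B] [Module.Finite ℤ B]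

omit [Module.Finite ℤ B] in
/-- If every homomorphism `B → ℤ/ℓ` vanishes then `B = ℓB` (the quotient `B/ℓB` is an `𝔽_ℓ`-vector space,
whose coordinate functionals separate points). [folklore] -/
private theorem exists_smul_eq_of_forall_hom_zmod {ℓ : ℕ} [Fact ℓ.Prime]
    (h : ∀ χ : B →ₗ[ℤ] ZMod ℓ, χ = 0) (b : B) : ∃ c : B, (ℓ : ℤ) • c = b := by
  let P : Submodule ℤ B := LinearMap.range ((ℓ : ℤ) • (LinearMap.id : B →ₗ[ℤ] B))
  have hP : ∀ x : B ⧸ P, ℓ • x = 0 := by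
    intro x
    obtain ⟨a, rfl⟩ := Submodule.mkQ_surjective P x
    rw [← map_nsmul, Submodule.mkQ_apply, Submodule.Quotient.mk_eq_zero, LinearMap.mem_range]
    exact ⟨a, by simp⟩
  -- `haveI`, not `letI`: the `match`-defined structure `AddCommGroup.zmodModule` must stay opaque
  haveI instMod : Module (ZMod ℓ) (B ⧸ P) := AddCommGroup.zmodModule hP
  by_contra hb
  have hmk : P.mkQ b ≠ 0 := by
    rw [Ne, Submodule.mkQ_apply, Submodule.Quotient.mk_eq_zero, LinearMap.mem_range]
    rintro ⟨c, hc⟩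
    exact hb ⟨c, by simpa using hc⟩
  -- a coordinate functional of the `𝔽_ℓ`-vector space `B/ℓB` not vanishing at the class of `b`
  haveI : Module.Free (ZMod ℓ) (B ⧸ P) := Module.Free.of_divisionRing (ZMod ℓ) (B ⧸ P)
  let bV := Module.Free.chooseBasis (ZMod ℓ) (B ⧸ P)
  have hrepr : bV.repr (P.mkQ b) ≠ 0 := fun h0 ↦ hmk (bV.repr.map_eq_zero_iff.mp h0)
  obtain ⟨i, hi⟩ := Finsupp.ne_iff.mp hrepr
  let χ : B →ₗ[ℤ] ZMod ℓ := ((bV.coord i).toAddMonoidHom.comp P.mkQ.toAddMonoidHom).toIntLinearMap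
  have h1 := LinearMap.congr_fun (h χ) b
  exact hi (by simpa [χ] using h1)

/-- If every homomorphism `B → ℤ/ℓ` vanishes then multiplication by `ℓ` on `B` is injective (it is onto by
`exists_smul_eq_of_forall_hom_zmod`, and an onto endomorphism of a finitely generated module is injective —
Vasconcelos). [folklore] -/
private theorem smul_injective_of_forall_hom_zmod {ℓ : ℕ} [Fact ℓ.Prime]
    (h : ∀ χ : B →ₗ[ℤ] ZMod ℓ, χ = 0) : Function.Injective fun b : B ↦ (ℓ : ℤ) • b := by
  have hs : Function.Surjective ((ℓ : ℤ) • (LinearMap.id : B →ₗ[ℤ] B)) := fun b ↦ by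
    obtain ⟨c, hc⟩ := exists_smul_eq_of_forall_hom_zmod h b
    exact ⟨c, by simpa using hc⟩
  have hi := IsNoetherian.injective_of_surjective_endomorphism _ hs
  intro x y hxy
  exact hi (by simpa using hxy)

/-- If every homomorphism `B → ℤ/ℓ` vanishes for every prime `ℓ`, then `B` is torsion-free. [folklore] -/
private theorem isAddTorsionFree_of_forall_hom_zmod
    (h : ∀ ℓ : ℕ, ℓ.Prime → ∀ χ : B →ₗ[ℤ] ZMod ℓ, χ = 0) : IsAddTorsionFree B := by
  constructor
  intro n hn
  induction n using Nat.strong_induction_on with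
  | _ n ih =>
    rcases Nat.lt_or_ge n 2 with hlt | hge
    · obtain rfl : n = 1 := by omega
      intro x y hxy
      simpa using hxy
    · obtain ⟨p, hp, m, rfl⟩ := Nat.exists_prime_and_dvd (show n ≠ 1 by omega)
      have hm0 : m ≠ 0 := by
        rintro rfl
        exact hn (mul_zero p)
      have hm : m < p * m := by nlinarith [hp.two_le, Nat.pos_of_ne_zero hm0]
      haveI : Fact p.Prime := ⟨hp⟩
      have hinjp := smul_injective_of_forall_hom_zmod (B := B) (h p hp)
      have hinjm := ih m hm hm0
      intro x y hxy
      have hxy' : (p : ℤ) • (m • x) = (p : ℤ) • (m • y) := by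
        simpa only [natCast_zsmul, mul_smul] using hxy
      exact hinjm (hinjp hxy')

/-- **A finitely generated abelian group with no non-zero homomorphism to any `ℤ/ℓ` is trivial**: it is
torsion-free (`isAddTorsionFree_of_forall_hom_zmod`), hence free (PID), and a free `ℤ`-module with a basis
vector `e` has the non-zero homomorphism "`e`-coordinate mod `2`". [folklore] -/
private theorem eq_zero_of_forall_hom_zmod
    (h : ∀ ℓ : ℕ, ℓ.Prime → ∀ χ : B →ₗ[ℤ] ZMod ℓ, χ = 0) (b : B) : b = 0 := by
  haveI := isAddTorsionFree_of_forall_hom_zmod h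
  haveI : Module.Free ℤ B := Module.free_of_finite_type_torsion_free'
  let bB := Module.Free.chooseBasis ℤ B
  by_cases hι : IsEmpty (Module.Free.ChooseBasisIndex ℤ B)
  · have : bB.repr b = bB.repr 0 := Subsingleton.elim _ _
    exact bB.repr.injective this
  · rw [not_isEmpty_iff] at hι
    obtain ⟨i⟩ := hι
    haveI : Fact (Nat.Prime 2) := ⟨Nat.prime_two⟩
    let χ : B →ₗ[ℤ] ZMod 2 := (Int.castAddHom (ZMod 2)).toIntLinearMap ∘ₗ bB.coord i
    have hχ := LinearMap.congr_fun (h 2 Nat.prime_two χ) (bB i)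
    have h1 : χ (bB i) = 1 := by simp [χ]
    rw [h1, LinearMap.zero_apply] at hχ
    exact absurd hχ one_ne_zero

end Algebra

/-! ### `A = Γ₀(N)ᵃᵇ/Γ_epᵃᵇ` as a `ℤ`-module and the period map on it -/

section Quot

variable (N : ℕ)

/-- `Γ₀(N)ᵃᵇ` written additively (a `ℤ`-module; plumbing). [folklore] -/
abbrev abGamma0 : Type := Additive (Abelianization (Gamma0 N))

/-- The image of Knapp's `Γ_ep` in `Γ₀(N)ᵃᵇ`, as a `ℤ`-submodule (plumbing). [folklore] -/
def epImage : Submodule ℤ (abGamma0 N) :=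
  AddSubgroup.toIntSubmodule
    (Subgroup.toAddSubgroup ((ellipticParabolicSubgroup N).map Abelianization.of))

/-- `A = Γ₀(N)ᵃᵇ/Γ_epᵃᵇ = Γ₀(N)/(Γ_ep·[Γ₀(N),Γ₀(N)])` written additively (Knapp's presentation of
`H₁(X₀(N), ℤ)`; plumbing). [folklore] -/
abbrev abQuot : Type := abGamma0 N ⧸ epImage N

/-- The class `[γ] ∈ A` of `γ ∈ Γ₀(N)` (plumbing). [folklore] -/
def cls (γ : Gamma0 N) : abQuot N := (epImage N).mkQ (Additive.ofMul (Abelianization.of γ))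

/-- Membership in `epImage`. [folklore] -/
private theorem mem_epImage {x : abGamma0 N} :
    x ∈ epImage N ↔ Additive.toMul x ∈ (ellipticParabolicSubgroup N).map Abelianization.of :=
  Iff.rfl

/-- `[γδ] = [γ] + [δ]`. [folklore] -/
private theorem cls_mul (γ δ : Gamma0 N) : cls N (γ * δ) = cls N γ + cls N δ := by
  simp [cls, ofMul_mul]

/-- `[γ] = 0` for `γ ∈ Γ_ep`. [folklore] -/
private theorem cls_eq_zero_of_mem {γ : Gamma0 N} (h : γ ∈ ellipticParabolicSubgroup N) :
    cls N γ = 0 := by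
  rw [cls, Submodule.mkQ_apply, Submodule.Quotient.mk_eq_zero, mem_epImage]
  exact Subgroup.mem_map_of_mem _ h

/-- `[γ] = 0` only for `γ ∈ Γ_ep · [Γ₀(N), Γ₀(N)]`. [folklore] -/
private theorem mem_sup_of_cls_eq_zero {γ : Gamma0 N} (h : cls N γ = 0) :
    γ ∈ ellipticParabolicSubgroup N ⊔ commutator (Gamma0 N) := by
  rw [cls, Submodule.mkQ_apply, Submodule.Quotient.mk_eq_zero, mem_epImage] at h
  obtain ⟨k, hk, hkγ⟩ := Subgroup.mem_map.mp h
  have hkγ' : Abelianization.of k = Abelianization.of γ := by simpa using hkγ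
  have hq : k⁻¹ * γ ∈ commutator (Gamma0 N) := by
    rw [← Abelianization.ker_of, MonoidHom.mem_ker, map_mul, map_inv, hkγ', inv_mul_cancel]
  have := Subgroup.mul_mem_sup hk hq
  rwa [mul_inv_cancel_left] at this

/-- Every class is the class of a single `γ`. [folklore] -/
private theorem cls_surjective (a : abQuot N) : ∃ γ : Gamma0 N, cls N γ = a := by
  obtain ⟨x, rfl⟩ := Submodule.mkQ_surjective (epImage N) a
  obtain ⟨γ, hγ⟩ : ∃ γ : Gamma0 N, Abelianization.of γ = Additive.toMul x :=
    QuotientGroup.mk_surjective (Additive.toMul x)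
  exact ⟨γ, by rw [cls, hγ]; rfl⟩

variable [NeZero N]

/-- **The period homomorphism on `Γ₀(N)ᵃᵇ`**, additively: `[γ] ↦ (h ↦ {∞, γ∞}_h)` (Knapp (11.34): `γ ↦ [γ]`
composed with integration, (11.37)). [cite: Knapp1993, (11.34)–(11.37) (PDF p. 243)] -/
def abPeriod : abGamma0 N →ₗ[ℤ] Module.Dual ℂ (CuspForm (Gamma0 N) 2) :=
  (MonoidHom.toAdditiveLeft (Abelianization.lift (periodFunctionalHom N))).toIntLinearMap

/-- `abPeriod [γ] = {∞, γ∞}`. [folklore] -/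
private theorem abPeriod_ofMul_of (γ : Gamma0 N) :
    abPeriod N (Additive.ofMul (Abelianization.of γ)) = periodFunctional N γ := by
  simp [abPeriod, periodFunctionalHom]

/-- `Γ_ep` has zero periods (the tree's easy half, Knapp (11.36)). [folklore] -/
private theorem epImage_le_ker : epImage N ≤ LinearMap.ker (abPeriod N) := by
  intro x hx
  rw [mem_epImage] at hx
  obtain ⟨k, hk, hkx⟩ := Subgroup.mem_map.mp hx
  have hx' : x = Additive.ofMul (Abelianization.of k) := by
    rw [hkx]
    rfl
  rw [LinearMap.mem_ker, hx', abPeriod_ofMul_of]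
  exact periodFunctional_eq_zero_of_mem_ellipticParabolicSubgroup N hk

/-- **The period map `per : A = Γ₀(N)ᵃᵇ/Γ_epᵃᵇ → S₂(Γ₀(N))^∨`**, `[γ] ↦ {∞, γ∞}` (Knapp (11.34) with (11.37)).
[cite: Knapp1993, Prop. 11.22 and (11.37) (PDF pp. 242–243)] -/
def quotPeriod : abQuot N →ₗ[ℤ] Module.Dual ℂ (CuspForm (Gamma0 N) 2) :=
  (epImage N).liftQ (abPeriod N) (epImage_le_ker N)

/-- `per [γ] = {∞, γ∞}`. [folklore] -/
private theorem quotPeriod_cls (γ : Gamma0 N) : quotPeriod N (cls N γ) = periodFunctional N γ := by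
  rw [← abPeriod_ofMul_of]
  exact LinearMap.congr_fun ((epImage N).liftQ_mkQ (abPeriod N) (epImage_le_ker N)) _

/-- `per` takes values in the period homology `H`. [folklore] -/
private theorem quotPeriod_mem_periodHomology (a : abQuot N) : quotPeriod N a ∈ periodHomology N := by
  obtain ⟨γ, rfl⟩ := cls_surjective N a
  rw [quotPeriod_cls, ← SetLike.mem_coe, coe_periodHomology_eq_range]
  exact ⟨γ, rfl⟩

/-- `Γ₀(N)ᵃᵇ` is a finitely generated `ℤ`-module (`Γ₀(N)` is finitely generated). [folklore] -/
private theorem finite_abGamma0 : Module.Finite ℤ (abGamma0 N) := by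
  haveI : Group.FG (Abelianization (Gamma0 N)) :=
    Group.fg_of_surjective (f := Abelianization.of) (QuotientGroup.mk_surjective)
  infer_instance

/-- **The period map `per : Γ₀(N)ᵃᵇ/Γ_epᵃᵇ → S₂(Γ₀(N))^∨` is injective** — Knapp's Prop. 11.22 in the form
"`[γ] ↦ ∫_c ω` identifies `Γ₀(N)ᵃᵇ/Γ_epᵃᵇ` with the period lattice `H ≅ H₁(X₀(N), ℤ)`": `per` maps ONTO
`H ≅ ℤⁿ` (`n = 2 dim S₂`, Eichler–Shimura), every homomorphism `A → 𝔽_ℓ` factors through `per` by the count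
`dim Hom(A, 𝔽_ℓ) ≤ n` (all primes `ℓ`), so the complement `ker per` of a splitting has no homomorphism to any
`ℤ/ℓ` and vanishes. [cite: Knapp1993, Prop. 11.22 (PDF p. 242), (11.37) (p. 243), (11.42) (p. 246)] -/
theorem quotPeriod_injective : Function.Injective (quotPeriod N) := by
  classical
  -- (1) Eichler–Shimura: `H = ℤ`-span of an `ℝ`-basis `b` of `S₂^∨`, free of rank `n = 2 dim S₂`
  obtain ⟨n, b, hb⟩ := periodHomology_eq_span_basis_holds N
  have hn : n = 2 * Module.finrank ℂ (CuspForm (Gamma0 N) 2) := by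
    have h := Module.finrank_eq_card_basis b
    rw [Fintype.card_fin, finrank_real_of_complex, Subspace.dual_finrank_eq] at h
    omega
  set H' : Submodule ℤ (Module.Dual ℂ (CuspForm (Gamma0 N) 2)) := Submodule.span ℤ (Set.range b)
    with hH'
  let bZ : Module.Basis (Fin n) ℤ H' := b.restrictScalars ℤ
  haveI : Module.Free ℤ H' := Module.Free.of_basis bZ
  haveI : Module.Finite ℤ H' := Module.Finite.of_basis bZ
  -- (2) `per` co-restricted to `H'`, onto
  have hmem : ∀ a, quotPeriod N a ∈ H' := fun a ↦ by
    rw [hH', ← SetLike.mem_coe, ← hb]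
    exact quotPeriod_mem_periodHomology N a
  let perH : abQuot N →ₗ[ℤ] H' := LinearMap.codRestrict H' (quotPeriod N) hmem
  have hperH : ∀ a, (perH a : Module.Dual ℂ (CuspForm (Gamma0 N) 2)) = quotPeriod N a := fun a ↦ rfl
  have hsurj : Function.Surjective perH := by
    rintro ⟨y, hy⟩
    have hy' : y ∈ (periodHomology N : Set (Module.Dual ℂ (CuspForm (Gamma0 N) 2))) := by
      rw [hb]
      exact hy
    rw [coe_periodHomology_eq_range] at hy'
    obtain ⟨γ, hγ⟩ := hy'
    exact ⟨cls N γ, Subtype.ext (by rw [hperH, quotPeriod_cls, hγ])⟩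
  -- it suffices to show `ker perH = 0`
  suffices hker : ∀ a, perH a = 0 → a = 0 by
    intro a₁ a₂ h
    have h0 : perH (a₁ - a₂) = 0 := Subtype.ext (by rw [hperH, map_sub, h, sub_self]; rfl)
    exact sub_eq_zero.mp (hker _ h0)
  -- (3) every homomorphism `A → ℤ/ℓ` factors through `perH`, for every prime `ℓ`
  have stepA : ∀ ℓ : ℕ, ℓ.Prime → ∀ φ : abQuot N →ₗ[ℤ] ZMod ℓ,
      ∃ ψ : H' →ₗ[ℤ] ZMod ℓ, φ = ψ ∘ₗ perH := by
    intro ℓ hℓ φ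
    haveI : Fact ℓ.Prime := ⟨hℓ⟩
    -- (a) `Hom(A, 𝔽_ℓ) ↪ Z¹_EP(Γ₀(N), 𝔽_ℓ)`, so `dim Hom(A, 𝔽_ℓ) ≤ n`
    let ι : (abQuot N →ₗ[ℤ] ZMod ℓ) →ₗ[ZMod ℓ] epCocycles N (ZMod ℓ) :=
      { toFun := fun φ ↦ ⟨fun γ ↦ φ (cls N γ),
          fun γ δ ↦ by simp only [cls_mul, map_add],
          fun γ hγ ↦ by
            simp only [cls_eq_zero_of_mem N (mem_ellipticParabolicSubgroup_of_isParabolic hγ), map_zero],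
          fun γ hγ ↦ by
            simp only [cls_eq_zero_of_mem N (mem_ellipticParabolicSubgroup_of_isElliptic hγ), map_zero]⟩
        map_add' := fun _ _ ↦ rfl
        map_smul' := fun _ _ ↦ rfl }
    have hι : Function.Injective ι := by
      intro φ₁ φ₂ h
      apply LinearMap.ext
      intro a
      obtain ⟨γ, rfl⟩ := cls_surjective N a
      exact congr_arg (fun u : epCocycles N (ZMod ℓ) ↦ (u : Gamma0 N → ZMod ℓ) γ) h
    haveI := finite_epCocycles N (ZMod ℓ)
    haveI : Module.Finite (ZMod ℓ) (abQuot N →ₗ[ℤ] ZMod ℓ) := Module.Finite.of_injective ι hι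
    have hA : Module.finrank (ZMod ℓ) (abQuot N →ₗ[ℤ] ZMod ℓ) ≤ n := by
      refine (LinearMap.finrank_le_finrank_of_injective hι).trans ?_
      rw [hn]
      exact finrank_epCocycles_le_two_mul_finrank N (ZMod ℓ)
    -- (b) `Hom(H', 𝔽_ℓ) ≅ 𝔽_ℓⁿ`
    let e : (Fin n → ZMod ℓ) ≃ₗ[ZMod ℓ] (H' →ₗ[ℤ] ZMod ℓ) := bZ.constr (ZMod ℓ)
    haveI : Module.Finite (ZMod ℓ) (H' →ₗ[ℤ] ZMod ℓ) := Module.Finite.equiv e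
    have hH : Module.finrank (ZMod ℓ) (H' →ₗ[ℤ] ZMod ℓ) = n := by
      rw [← e.finrank_eq, Module.finrank_fintype_fun_eq_card, Fintype.card_fin]
    -- (c) the pull-back along the surjection `perH` is injective, hence onto by dimension
    let pull : (H' →ₗ[ℤ] ZMod ℓ) →ₗ[ZMod ℓ] (abQuot N →ₗ[ℤ] ZMod ℓ) :=
      { toFun := fun ψ ↦ ψ ∘ₗ perH
        map_add' := fun _ _ ↦ rfl
        map_smul' := fun _ _ ↦ rfl }
    have hpull : Function.Injective pull := fun ψ₁ ψ₂ h ↦ (LinearMap.cancel_right hsurj).mp h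
    have hle := LinearMap.finrank_le_finrank_of_injective hpull
    have heq : Module.finrank (ZMod ℓ) (H' →ₗ[ℤ] ZMod ℓ) =
        Module.finrank (ZMod ℓ) (abQuot N →ₗ[ℤ] ZMod ℓ) := by omega
    obtain ⟨ψ, hψ⟩ := (LinearMap.injective_iff_surjective_of_finrank_eq_finrank heq).mp hpull φ
    exact ⟨ψ, hψ.symm⟩
  -- (4) `H'` is free, so `perH` splits; the kernel has no homomorphism to any `ℤ/ℓ`
  obtain ⟨s, hs⟩ := Module.projective_lifting_property perH LinearMap.id hsurj
  intro a ha
  let q : abQuot N →ₗ[ℤ] abQuot N := LinearMap.id - s ∘ₗ perH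
  have hq : ∀ x, q x = x - s (perH x) := fun x ↦ rfl
  have hproj : ∀ x : abQuot N, q x ∈ LinearMap.ker perH := fun x ↦ by
    rw [LinearMap.mem_ker, hq, map_sub, ← LinearMap.comp_apply, hs, LinearMap.id_apply, sub_self]
  let πB : abQuot N →ₗ[ℤ] LinearMap.ker perH := LinearMap.codRestrict _ q hproj
  have hπB : ∀ x : LinearMap.ker perH, πB x = x := fun x ↦ by
    apply Subtype.ext
    rw [LinearMap.codRestrict_apply, hq, LinearMap.mem_ker.mp x.2, map_zero, sub_zero]
  have hB : ∀ ℓ : ℕ, ℓ.Prime → ∀ χ : LinearMap.ker perH →ₗ[ℤ] ZMod ℓ, χ = 0 := by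
    intro ℓ hℓ χ
    obtain ⟨ψ, hψ⟩ := stepA ℓ hℓ (χ ∘ₗ πB)
    apply LinearMap.ext
    intro x
    have h1 := LinearMap.congr_fun hψ x
    rw [LinearMap.comp_apply, LinearMap.comp_apply, hπB, LinearMap.mem_ker.mp x.2, map_zero] at h1
    rw [h1, LinearMap.zero_apply]
  -- (5) the kernel is a finitely generated abelian group, hence zero
  haveI := finite_abGamma0 N
  haveI : Module.Finite ℤ (abQuot N) :=
    Module.Finite.of_surjective (epImage N).mkQ (Submodule.mkQ_surjective _)
  haveI : IsNoetherian ℤ (abQuot N) := isNoetherian_of_isNoetherianRing_of_finite ℤ (abQuot N)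
  haveI : Module.Finite ℤ (LinearMap.ker perH) := Module.Finite.iff_fg.mpr (IsNoetherian.noetherian _)
  have h0 := eq_zero_of_forall_hom_zmod hB ⟨a, ha⟩
  exact congr_arg Subtype.val h0

end Quot

/-! ### The discharge -/

section Discharge

/-- **Knapp's Prop. 11.22 with (11.37) and (11.42), PROVED: the period homomorphism `γ ↦ {∞, γ∞}`,
`Γ₀(N) → S₂(Γ₀(N))^∨`, vanishes ONLY on `Γ_ep · [Γ₀(N), Γ₀(N)]`** — if `{∞, γ∞}_h = 0` for every weight-`2`
cusp form `h` on `Γ₀(N)` then `γ` lies in the subgroup generated by the elliptic elements, the parabolic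
elements and the commutators of `Γ₀(N)` (equivalently: Manin's presentation of `H₁(X₀(N), ℤ)` is exact over
`ℤ`, Manin 1972 Thm. 1.9 / Cremona 1997 Thm. 2.1.2).  Discharges the named fact
`periodFunctional_ker_le_ellipticParabolic_sup_commutator` of `PeriodHomologyGroupPresentation` for every
`N ≥ 1` (`quotPeriod_injective`: `[γ] = 0` in `Γ₀(N)ᵃᵇ/Γ_epᵃᵇ`, i.e. `γ ∈ Γ_ep·[Γ₀(N),Γ₀(N)]`).
[cite: Knapp1993, Prop. 11.22 (PDF p. 242), (11.36)–(11.37) (p. 243), (11.42) (p. 246)]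
[cite: Manin1972, Thm. 1.9] [cite: CremonaAlgorithms1997, §2.1 Thm. 2.1.2] -/
theorem periodFunctional_ker_le_ellipticParabolic_sup_commutator_holds :
    periodFunctional_ker_le_ellipticParabolic_sup_commutator := by
  intro N _ γ hγ
  apply mem_sup_of_cls_eq_zero N
  apply quotPeriod_injective N
  rw [quotPeriod_cls, map_zero, hγ]

variable {N : ℕ} [NeZero N]

/-- **`{∞, γ∞} = 0 ↔ γ ∈ Γ_ep · [Γ₀(N), Γ₀(N)]`**, unconditionally (Knapp's (11.34) read through (11.37)).
[cite: Knapp1993, Prop. 11.22 (PDF p. 242)] -/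
theorem periodFunctional_eq_zero_iff_mem_holds (γ : Gamma0 N) :
    periodFunctional N γ = 0 ↔ γ ∈ ellipticParabolicSubgroup N ⊔ commutator (Gamma0 N) :=
  periodFunctional_eq_zero_iff_mem periodFunctional_ker_le_ellipticParabolic_sup_commutator_holds γ

/-- **`ker(γ ↦ {∞, γ∞}) = Γ_ep ⊔ [Γ₀(N), Γ₀(N)]`**, unconditionally: `γ ↦ {∞, γ∞}` induces an isomorphism of
`Γ₀(N)ᵃᵇ/Γ_epᵃᵇ` onto the period homology `H₁(X₀(N), ℤ) ⊆ S₂(Γ₀(N))^∨`.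
[cite: Knapp1993, Prop. 11.22 and (11.37) (PDF pp. 242–243)] -/
theorem ker_periodFunctionalHom_eq_holds :
    (periodFunctionalHom N).ker = ellipticParabolicSubgroup N ⊔ commutator (Gamma0 N) :=
  ker_periodFunctionalHom_eq periodFunctional_ker_le_ellipticParabolic_sup_commutator_holds

end Discharge

end Literature.NumberTheory.ModularSymbols
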